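/-
Copyright (c) 2026 the pub-hodgecm-mathlib formalisation cell (harness21).  Prover seat hodgecm-mathlib-K2E3-p29 (g0), HCML Track B «K2-LIT» (build stream 29),
h413 = `stmt-HodgeConjecture-24833`, line `K2_E3_EllipticInputs`, unit U12 «Characters», PART «SC» leaf (SC-an)₂ (road «FC₂», CLOSE-OUT DAY strike line L4 `stub_StCharTS`,
LINE-LEAD K2E3-plan (g4), deal D135 sequel, architect K2E3-p25 (g3)): the PLACE-LEVEL heads of the (M5h)₂ weight kit on `U(σ_w, J)(L_w)`, `J = (StdForm.antidiagonal 2).over L_w`,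
UNCONDITIONAL — §4 `T⁻¹(1+|log T|)^k ∈ L¹_loc` with the (ε6)₂ letter of ★ p861141 `K2E3SupercuspidalTruncatedCharWeightKitTwo` DISCHARGED by ★∕📤 (ε-Model₂)
`K2E3U11WeylDiscrModelRpow.hHCD_five_sixteenths`.  (§1₂, the split shell bound at the place, joins this file by the append protocol once `…BallBoundSplitAssemblyTwo` and the
split-torus trio₂ are ★.)  2026-09-04.
-/
import Summits.HodgeConjecture.HodgeConjecture.Theorems.K2E3SupercuspidalTruncatedCharWeightKitTwo   -- ★ p861141 (this seat): `locallyIntegrable_inv_token_rpow_five_quarters_place`, `…_mul_log_pow_place` (hypothesis-first on `hHCD`)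
import Summits.HodgeConjecture.HodgeConjecture.Theorems.K2E3U11WeylDiscrModelRpow                     -- ★∕📤 p861225 (this seat) (ε-Model₂): `hHCD_five_sixteenths` (the letter, proved)
import HarnessLib

/-!
# h413 ∕ Track B «K2-LIT», (SC-an)₂ ∕ (M5h)₂ — FILE A′ «WEIGHT KIT AT THE PLACE», TWO VARIABLES: `T⁻¹(1 + |log T|)^k ∈ L¹_loc(U(σ_w, Φ₂)(L_w), ν)` UNCONDITIONALLY
# (Harish-Chandra 1970, Part VII §1 Theorem 15 with ε-room at rank one, §3 p. 73)

Cell `pub/hodgecm-mathlib`, crux H413 = `stmt-HodgeConjecture-24833`, route of record `HCCMUnconditional`; LINE-LEAD ∕ dealer K2E3-plan (g4) (deal D135, L4 EMIT #1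
2026-09-04T14:52:25Z; this seat's R0 14:55:02Z «§4 hypothesis-first, then the (ε)₂ re-thread discharges it»), (M5h)₂ payer K2E3-p23 (g7) (D148), chain desk K2E3-p27 (g0).
THEOREMS ONLY (no `def`, no `instance`, no `notation`, no named-fact hypothesis, no `sorry`); lane `--supports stmt-HodgeConjecture-24833 --as helper`, count-neutral.

WHAT.  The template ★ (M5h) FILE A `K2E3SupercuspidalTruncatedCharWeightKit` §4 proves, on the `3 × 3` place model, `(T^{1+1∕4})⁻¹ ∈ L¹_loc` and `T⁻¹(1 + |log T|)^k ∈ L¹_loc`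
(`T = √√(|disc χ|·|det|⁻²)`) from ★ (ε6) `hcd_model_rpow`.  Its `Fin 2` twin ★ `K2E3SupercuspidalTruncatedCharWeightKitTwo` §4′ proved the same two statements on `U(σ_w, J)(L_w)`,
`J : Matrix (Fin 2) (Fin 2) L_w`, FROM the rank-one (ε6)₂ letter `hHCD : ∀ g₀, ∃ U ∈ 𝓝 g₀, ∫⁻_U (↑(|disc χ_g|·|det g|⁻²))^{−(1+1∕4)∕4} ∂ν < ∞`; the «(ε)₂ re-thread» ★ p861168
(ε-Lie₂) ∕ ★ p861179 (ε-Cayley₂) ∕ ★∕📤 p861225 (ε-Model₂) proves that letter for `J = (StdForm.antidiagonal 2).over L_w` (`hHCD_five_sixteenths`).  This file composes the two: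
* §4 **`locallyIntegrable_inv_token_rpow_five_quarters`**, **`locallyIntegrable_inv_token_mul_log_pow`** — with EXACTLY the template's binder shape `(L w hw) {J} (hJ) [..] (ν) [Haar]
  (k)` at `Fin 2`: the names the (M5h)₂ ports (`…AnalyticOfEllWeightPlaceTwo` D148, `…OfHC14EllPlaceTwo`, `K2E3EllWeightPlaceOfHC14EllPlaceTwo`) substitute for the template's
  `K2E3SupercuspidalTruncatedCharWeightKit.locallyIntegrable_inv_token_*` (module `…WeightKitPlaceTwo` instead of `…WeightKit`; the GENERIC §2 `exists_shellIndex` ∕ §5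
  `measurable_find` ∕ `locallyIntegrable_heightWeight` keep the `…WeightKit.` prefix; §1₂ pending).

HONEST LABEL.  HC_CM is proved only modulo the 7 printed citations (2 remaining named inputs: hLiu418 = `stmt-HodgeConjecture-24832`, h413 = `stmt-HodgeConjecture-24833`)
until rung 0 closes; count-neutral helper (measure-theoretic packaging; nothing printed is asserted as a fact); (SC-an)₂ stays OPEN until the whole (M5h)₂ chain and the FC₂
letters are ★ and PART «SC» is tied.

## References
* [HarishChandra1970] Harish-Chandra (notes by G. van Dijk), *Harmonic Analysis on Reductive p-adic Groups*, LNM 162 (1970), Part VII §1 Thm. 15 p. 63 (`|D|^{−1∕2−ε} ∈ L¹_loc`),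
  §3 p. 73.
* [Rogawski1990] J. D. Rogawski, *Automorphic Representations of Unitary Groups in Three Variables*, Ann. of Math. Stud. 123 (1990), §4.9 p. 54, §12.5 p. 182.
* [Folland1999] G. B. Folland, *Real Analysis* (2nd ed., 1999), §3.3 (products with locally bounded factors).
-/

set_option autoImplicit false
-- the mandated namespace repeats the single-problem summit's segment (`HodgeConjecture.HodgeConjecture`)
set_option linter.dupNamespace false

noncomputable section

open MeasureTheory Measure Set Filter Topology NumberField IsDedekindDomain
open scoped NNReal ENNReal Pointwise Matrix MatrixGroups WithZero
open ValuativeRel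
open Literature.NumberTheory.Automorphic Literature.NumberTheory.Automorphic.UnitaryGroup Literature.NumberTheory.Rogawski1990
open Literature.NumberTheory.GaloisRepresentations Literature.NumberTheory.GaloisRepresentations.IsNonarchimedeanLocalField

namespace Summit.HodgeConjecture.HodgeConjecture.Cruxes.H413.K2E3SupercuspidalTruncatedCharWeightKitPlaceTwo

/-! ## §4 `T⁻¹(1 + |log T|)^k` is locally integrable on `U(σ_w, Φ₂)(L_w)` — unconditional -/

section LocInt

variable (L : Type) [Field L] [NumberField L] [IsCMField L] {v : HeightOneSpectrum (𝓞 ↥(maximalRealSubfield L))}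
  (w : PlacesOver L v) (hw : IsCMField.complexConj L • w.1 = w.1)

/-- **`(T^{1+δ})⁻¹ ∈ L¹_loc(U(σ_w, Φ₂)(L_w), ν)` at `δ = 1∕4`**, every Haar `ν`, `J = (StdForm.antidiagonal 2).over L_w`, `T = √√(|disc χ|·|det|⁻²)`: ★ `K2E3SupercuspidalTruncatedCharWeightKitTwo.
locallyIntegrable_inv_token_rpow_five_quarters_place` with its (ε6)₂ letter `hHCD` := ★ `K2E3U11WeylDiscrModelRpow.hHCD_five_sixteenths` (Harish-Chandra's `|D|^{−1∕2−ε}` on the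
rank-one model: (ε-Lie₂) → (ε-Cayley₂) → (ε-Model₂), `r = 5∕16`, `2r = 5∕8 < 1`).  The `Fin 2` twin of ★ `…WeightKit.locallyIntegrable_inv_token_rpow_five_quarters`, same binders.
[cite: HarishChandra1970, Part VII §1 Thm. 15 p. 63] -/
theorem locallyIntegrable_inv_token_rpow_five_quarters {J : Matrix (Fin 2) (Fin 2) (w.1.adicCompletion L)}
    (hJ : J = (StdForm.antidiagonal 2).over (w.1.adicCompletion L))
    [MeasurableSpace ↥(unitaryGroupOfForm (galAdicCompletionMap (L := L) (IsCMField.complexConj L) hw) J)]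
    [BorelSpace ↥(unitaryGroupOfForm (galAdicCompletionMap (L := L) (IsCMField.complexConj L) hw) J)]
    (ν : Measure ↥(unitaryGroupOfForm (galAdicCompletionMap (L := L) (IsCMField.complexConj L) hw) J)) [ν.IsHaarMeasure] :
    LocallyIntegrable (fun m : ↥(unitaryGroupOfForm (galAdicCompletionMap (L := L) (IsCMField.complexConj L) hw) J) =>
      ((((NNReal.sqrt (NNReal.sqrt
        (normAbs (w.1.adicCompletion L) (((m : GL (Fin 2) (w.1.adicCompletion L)) : Matrix (Fin 2) (Fin 2) (w.1.adicCompletion L))).charpoly.discr *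
          (normAbs (w.1.adicCompletion L) (((m : GL (Fin 2) (w.1.adicCompletion L)) : Matrix (Fin 2) (Fin 2) (w.1.adicCompletion L))).det ^ 2)⁻¹)) : ℝ≥0) : ℝ)) ^
        (1 + (1 / 4 : ℝ)))⁻¹) ν :=
  K2E3SupercuspidalTruncatedCharWeightKitTwo.locallyIntegrable_inv_token_rpow_five_quarters_place L w hw J ν
    (K2E3U11WeylDiscrModelRpow.hHCD_five_sixteenths L v w hw hJ ν)

/-- **`T⁻¹ (1 + |log T|)^k ∈ L¹_loc(U(σ_w, Φ₂)(L_w), ν)`** for every Haar `ν` and every `k : ℕ`, `J = (StdForm.antidiagonal 2).over L_w` — UNCONDITIONAL: ★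
`K2E3SupercuspidalTruncatedCharWeightKitTwo.locallyIntegrable_inv_token_mul_log_pow_place` (★ p856410 `locallyIntegrable_inv_mul_log_pow`, `δ = 1∕4`, continuity of the token) with
its (ε6)₂ letter := ★ `K2E3U11WeylDiscrModelRpow.hHCD_five_sixteenths`.  This is the `hW` input of the (M5h)₂ packaging on the model, with room for any polynomial-in-`log` factor;
the `Fin 2` twin of ★ `…WeightKit.locallyIntegrable_inv_token_mul_log_pow`, same binders. [cite: HarishChandra1970, Part VII §1 Thm. 15 p. 63; §3 p. 73] [cite: Folland1999, §3.3] -/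
theorem locallyIntegrable_inv_token_mul_log_pow {J : Matrix (Fin 2) (Fin 2) (w.1.adicCompletion L)}
    (hJ : J = (StdForm.antidiagonal 2).over (w.1.adicCompletion L))
    [MeasurableSpace ↥(unitaryGroupOfForm (galAdicCompletionMap (L := L) (IsCMField.complexConj L) hw) J)]
    [BorelSpace ↥(unitaryGroupOfForm (galAdicCompletionMap (L := L) (IsCMField.complexConj L) hw) J)]
    (ν : Measure ↥(unitaryGroupOfForm (galAdicCompletionMap (L := L) (IsCMField.complexConj L) hw) J)) [ν.IsHaarMeasure] (k : ℕ) :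
    LocallyIntegrable (fun m : ↥(unitaryGroupOfForm (galAdicCompletionMap (L := L) (IsCMField.complexConj L) hw) J) =>
      (((NNReal.sqrt (NNReal.sqrt
        (normAbs (w.1.adicCompletion L) (((m : GL (Fin 2) (w.1.adicCompletion L)) : Matrix (Fin 2) (Fin 2) (w.1.adicCompletion L))).charpoly.discr *
          (normAbs (w.1.adicCompletion L) (((m : GL (Fin 2) (w.1.adicCompletion L)) : Matrix (Fin 2) (Fin 2) (w.1.adicCompletion L))).det ^ 2)⁻¹)) : ℝ≥0) : ℝ))⁻¹ *
        (1 + |Real.log (((NNReal.sqrt (NNReal.sqrt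
          (normAbs (w.1.adicCompletion L) (((m : GL (Fin 2) (w.1.adicCompletion L)) : Matrix (Fin 2) (Fin 2) (w.1.adicCompletion L))).charpoly.discr *
            (normAbs (w.1.adicCompletion L) (((m : GL (Fin 2) (w.1.adicCompletion L)) : Matrix (Fin 2) (Fin 2) (w.1.adicCompletion L))).det ^ 2)⁻¹)) : ℝ≥0) : ℝ))|) ^ k) ν :=
  K2E3SupercuspidalTruncatedCharWeightKitTwo.locallyIntegrable_inv_token_mul_log_pow_place L w hw J ν k
    (K2E3U11WeylDiscrModelRpow.hHCD_five_sixteenths L v w hw hJ ν)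

end LocInt

end Summit.HodgeConjecture.HodgeConjecture.Cruxes.H413.K2E3SupercuspidalTruncatedCharWeightKitPlaceTwo

end
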